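import Summits.CriticalPhenomena.SAWScalingLimit.Theses.SAWDefectDecoherence
import Summits.CriticalPhenomena.SAWScalingLimit.Theorems.SAWDefectDecoherenceConjugateClassNegligibleOfLimitStar
import HarnessLib

/-!
# `ConjugateClassNegligible` from a continuous local limit of the normalised observable

Route `SAWDefectDecoherence` of `CriticalPhenomena/SAWScalingLimit`, node `ConjugateClassNegligible`
(item `stmt-CriticalPhenomena-8551`). This file records the EXPONENT-FREE sufficient condition for
the node: if, along every admissible discretisation family, the normalised observable
`F_δ(e)/F_δ(b_δ)` is approximated, uniformly over the domain mid-edges `e` whose rescaled position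
lies in a given compact `K ⊂ Ω`, by `f(δ·mid e)` for SOME function `f` continuous on `Ω` (the
interior statement of Duminil-Copin–Smirnov's Conjecture 2, arXiv:1007.0575 §4, with the limit left
unspecified), then the conjugate-class (`ū`-twisted) average of the statement is
`o(δ⁻²) · F_δ(b_δ)` — and this for merely continuous compactly supported test functions `ψ`.

The mechanism is elementary and uses nothing about self-avoiding walks: at a black vertex `v` the
three conjugated edge vectors sum to zero (`Σ_{t ∼ v} conj(c_t - c_v) = 0`, the vertex is the
barycentre of its neighbours), so the `ψ`-weighted conjugate star sum of any edge function that is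
`η`-close to a continuous function of position is bounded by `3 (1 + ‖ψ‖_∞) η` once the modulus of
continuity of `ψ f` at scale `δ/2` is below `η` (`star_estimate` of the `…OfLimitStar` file); there
are `O(δ⁻²)` black vertices under the support (`sq_mul_card_filter_le`), whence the claim
(`tendsto_conjClass_zero_of_localLimit`, abstract in the edge function;
`conjugateClassNegligible_of_localLimit`, the node).

Compare the route's own synthesis `conjugateClassNegligible_of_cruxes`
(`Theorems/SAWDefectDecoherenceConjugateClassNegligible.lean`), which avoids assuming any limit and
instead pays with the two exponent cruxes `DefectDecoherence` and `MassRatio` (and needs `ψ ∈ C¹`).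
In the other direction nothing is claimed: the node is strictly weaker than a pointwise limit (it is
a statement about one Fourier mode of the orientation-resolved observable only).
-/

noncomputable section

open scoped BigOperators Topology
open Filter Set Metric
open Literature.Probability.LatticeModels Literature.Probability.RandomPlanarGeometry
open Literature.Probability.RandomPlanarGeometry.SAW
open Summit.CriticalPhenomena.SAWScalingLimit.Theses.SAWDefectDecoherence
open Summit.CriticalPhenomena.SAWScalingLimit.Theorems.ConjugateClassNegligibleSynthesis

namespace Summit.CriticalPhenomena.SAWScalingLimit.Theorems

namespace ConjugateClassNegligibleOfLimit

/-! ### The abstract limit theorem -/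

/-- A continuous `ψ` supported inside the open set `Ω`, times a function continuous on `Ω`, is
continuous on the whole plane. [folklore] -/
theorem continuous_mul_of_continuousOn {Ω : Set ℂ} (hΩ : IsOpen Ω) {ψ f : ℂ → ℂ}
    (hψ : Continuous ψ) (hψs : tsupport ψ ⊆ Ω) (hf : ContinuousOn f Ω) :
    Continuous fun z => ψ z * f z := by
  rw [continuous_iff_continuousAt]
  intro z
  by_cases hz : z ∈ Ω
  · exact hψ.continuousAt.mul (hf.continuousAt (hΩ.mem_nhds hz))
  · have hz' : z ∉ tsupport ψ := fun h => hz (hψs h)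
    rw [notMem_tsupport_iff_eventuallyEq] at hz'
    have h0 : (fun w => ψ w * f w) =ᶠ[𝓝 z] fun _ => (0 : ℂ) :=
      hz'.mono fun w hw => by
        show ψ w * f w = 0
        rw [hw, Pi.zero_apply, zero_mul]
    exact h0.continuousAt

/-- **Conjugate-class averages of edge functions with a continuous local limit are `o(δ⁻²)`.**
Let `Λ_δ` exhaust the compacts of the open set `Ω`, and let the edge functions `F_δ/N_δ` be
approximated, uniformly over the domain mid-edges under any compact `K ⊂ Ω` and eventually as
`δ → 0⁺`, by `f(δ·mid e)` for one function `f` continuous on `Ω`. Then for every continuous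
compactly supported `ψ` with `tsupport ψ ⊆ Ω`,
`δ² Σ_{black v ∼ t, {v,t} ∈ Ω_δ} ψ(δ·mid) conj(c_t - c_v) F_δ({v,t}) / N_δ → 0`. [folklore] -/
theorem tendsto_conjClass_zero_of_localLimit {Ω : Set ℂ} (hΩ : IsOpen Ω)
    (Λ : ℝ → Finset HexVertex) (F : ℝ → Sym2 HexVertex → ℂ) (Nm : ℝ → ℂ) (f : ℂ → ℂ)
    (hf : ContinuousOn f Ω)
    (hexh : ∀ K : Set ℂ, IsCompact K → K ⊆ Ω →
      ∀ᶠ δ : ℝ in 𝓝[>] 0, ∀ v : HexVertex, (δ : ℂ) * hexCenter v ∈ K → v ∈ Λ δ)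
    (happ : ∀ K : Set ℂ, IsCompact K → K ⊆ Ω → ∀ ε : ℝ, 0 < ε → ∀ᶠ δ : ℝ in 𝓝[>] 0,
      ∀ e ∈ hexDomainMidEdges (Λ δ), (δ : ℂ) * hexMidpoint e ∈ K →
        ‖F δ e / Nm δ - f ((δ : ℂ) * hexMidpoint e)‖ ≤ ε)
    {ψ : ℂ → ℂ} (hψ : Continuous ψ) (hψc : HasCompactSupport ψ) (hψs : tsupport ψ ⊆ Ω) :
    Tendsto (fun δ : ℝ => (δ : ℂ) ^ 2 *
        (∑ᶠ p ∈ {p : HexVertex × HexVertex | s(p.1, p.2) ∈ hexDomainMidEdges (Λ δ) ∧ p.1.2 = 0},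
          ψ ((δ : ℂ) * hexMidpoint s(p.1, p.2)) * (starRingEnd ℂ) (hexCenter p.2 - hexCenter p.1) *
            F δ s(p.1, p.2)) / Nm δ)
      (𝓝[>] 0) (𝓝 0) := by
  classical
  -- constants attached to `ψ`
  obtain ⟨Mψ, hMψ⟩ := hψ.bounded_above_of_compact_support hψc
  have hMψ0 : 0 ≤ Mψ := (norm_nonneg _).trans (hMψ 0)
  have hK₀ : IsCompact (tsupport ψ) := hψc
  obtain ⟨r, hr, hrsub⟩ := hK₀.exists_cthickening_subset_open hΩ hψs
  have hK₂ : IsCompact (cthickening r (tsupport ψ)) := hK₀.cthickening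
  obtain ⟨R₂, hR₂0, hK₂R⟩ := hK₂.isBounded.subset_closedBall_lt 0 0
  set Cc : ℝ := 2 * (4 * R₂ + 11) ^ 2 with hCc
  -- the continuous compactly supported product `ψ f`
  have hgc : Continuous fun z => ψ z * f z := continuous_mul_of_continuousOn hΩ hψ hψs hf
  have hgs : HasCompactSupport fun z => ψ z * f z := hψc.mul_right
  have hgu : UniformContinuous fun z => ψ z * f z := hgs.uniformContinuous_of_continuous hgc
  -- ε-management
  rw [Metric.tendsto_nhds]
  intro ε hε
  set η : ℝ := ε / (3 * (1 + Mψ) * Cc + 1) with hηdef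
  have hA : 0 ≤ 3 * (1 + Mψ) * Cc := by positivity
  have hη : 0 < η := by positivity
  obtain ⟨θ, hθ, hgθ⟩ := Metric.uniformContinuous_iff.1 hgu η hη
  have hθev : ∀ᶠ δ : ℝ in 𝓝[>] 0, δ < θ :=
    (eventually_lt_nhds hθ).filter_mono nhdsWithin_le_nhds
  have h1ev : ∀ᶠ δ : ℝ in 𝓝[>] 0, δ < 1 :=
    (eventually_lt_nhds one_pos).filter_mono nhdsWithin_le_nhds
  have hrev : ∀ᶠ δ : ℝ in 𝓝[>] 0, δ < r / 2 :=
    (eventually_lt_nhds (half_pos hr)).filter_mono nhdsWithin_le_nhds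
  have hpos : ∀ᶠ δ : ℝ in 𝓝[>] 0, 0 < δ := eventually_mem_nhdsWithin
  have hall := ((hexh _ hK₂ hrsub).and (happ _ hK₂ hrsub η hη)).and
    ((hθev.and h1ev).and (hrev.and hpos))
  refine hall.mono fun δ hδall => ?_
  obtain ⟨⟨hexδ, happδ⟩, ⟨hδθ, hδ1⟩, hδr, hδ⟩ := hδall
  rw [dist_zero_right]
  -- to an iterated finite sum over black vertices of `Λ δ` and their neighbours in `Λ δ`
  have hfz : ∀ p ∈ {p : HexVertex × HexVertex | s(p.1, p.2) ∈ hexDomainMidEdges (Λ δ) ∧ p.1.2 = 0},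
      ψ ((δ : ℂ) * hexMidpoint s(p.1, p.2)) * (starRingEnd ℂ) (hexCenter p.2 - hexCenter p.1) *
        F δ s(p.1, p.2) ≠ 0 → p.1 ∈ Λ δ ∧ p.2 ∈ Λ δ := by
    intro p hp hne
    have hadj : hexGraph.Adj p.1 p.2 := (SimpleGraph.mem_edgeSet _).1 hp.1.1
    have hψ0 : ψ ((δ : ℂ) * hexMidpoint s(p.1, p.2)) ≠ 0 := by
      intro h0; apply hne; rw [h0, zero_mul, zero_mul]
    have hmid : (δ : ℂ) * hexMidpoint s(p.1, p.2) ∈ tsupport ψ := subset_tsupport _ hψ0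
    constructor
    · refine hexδ _ (mem_of_dist_le_of_mem_tsupport subset_rfl hmid ?_)
      rw [dist_comm]
      exact (dist_mid_center_le hδ.le hadj).trans (by linarith)
    · refine hexδ _ (mem_of_dist_le_of_mem_tsupport subset_rfl hmid ?_)
      rw [dist_comm]
      exact (dist_mid_center_le' hδ.le hadj).trans (by linarith)
  rw [finsum_pairSet_eq (Λ δ) _ hfz, mul_div_assoc, Finset.sum_div]
  simp_rw [Finset.sum_div, mul_div_assoc]
  -- oscillation of `ψ f` at scale `δ/2`
  have hg : ∀ x y : ℂ, dist x y ≤ δ / 2 →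
      ‖ψ x * f x - ψ y * f y‖ ≤ η := by
    intro x y hxy
    rw [← dist_eq_norm]
    exact (hgθ (lt_of_le_of_lt hxy (by linarith))).le
  -- the star estimate at every black vertex
  have hstar : ∀ v ∈ (Λ δ).filter (fun v => v.2 = 0),
      ‖∑ t ∈ (Λ δ).filter (fun t => hexGraph.Adj v t),
          ψ ((δ : ℂ) * hexMidpoint s(v, t)) * (starRingEnd ℂ) (hexCenter t - hexCenter v) *
            (F δ s(v, t) / Nm δ)‖ ≤
        if ‖(δ : ℂ) * hexCenter v‖ ≤ R₂ then 3 * (1 + Mψ) * η else 0 := fun v hv =>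
    star_estimate (G := fun e => F δ e / Nm δ) hMψ hMψ0 hη.le hδ (by linarith) subset_rfl hK₂R
      hexδ happδ hg (Finset.mem_filter.1 hv).2
  have hcount := sq_mul_card_filter_le ((Λ δ).filter fun v => v.2 = 0) hδ hδ1.le hR₂0.le
  have hlt : Cc * (3 * (1 + Mψ) * η) < ε := by
    rw [show Cc * (3 * (1 + Mψ) * η) = 3 * (1 + Mψ) * Cc * ε / (3 * (1 + Mψ) * Cc + 1) by
      rw [hηdef]; ring]
    rw [div_lt_iff₀ (by positivity)]
    nlinarith
  calc ‖(δ : ℂ) ^ 2 * ∑ v ∈ (Λ δ).filter (fun v => v.2 = 0),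
          ∑ t ∈ (Λ δ).filter (fun t => hexGraph.Adj v t),
            ψ ((δ : ℂ) * hexMidpoint s(v, t)) * (starRingEnd ℂ) (hexCenter t - hexCenter v) *
              (F δ s(v, t) / Nm δ)‖
      = δ ^ 2 * ‖∑ v ∈ (Λ δ).filter (fun v => v.2 = 0),
          ∑ t ∈ (Λ δ).filter (fun t => hexGraph.Adj v t),
            ψ ((δ : ℂ) * hexMidpoint s(v, t)) * (starRingEnd ℂ) (hexCenter t - hexCenter v) *
              (F δ s(v, t) / Nm δ)‖ := by
        rw [norm_mul, norm_pow, Complex.norm_real, Real.norm_of_nonneg hδ.le]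
    _ ≤ δ ^ 2 * ∑ v ∈ (Λ δ).filter (fun v => v.2 = 0),
          ‖∑ t ∈ (Λ δ).filter (fun t => hexGraph.Adj v t),
            ψ ((δ : ℂ) * hexMidpoint s(v, t)) * (starRingEnd ℂ) (hexCenter t - hexCenter v) *
              (F δ s(v, t) / Nm δ)‖ :=
        mul_le_mul_of_nonneg_left (norm_sum_le _ _) (by positivity)
    _ ≤ δ ^ 2 * ∑ v ∈ (Λ δ).filter (fun v => v.2 = 0),
          (if ‖(δ : ℂ) * hexCenter v‖ ≤ R₂ then 3 * (1 + Mψ) * η else 0) :=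
        mul_le_mul_of_nonneg_left (Finset.sum_le_sum hstar) (by positivity)
    _ = δ ^ 2 * ((((Λ δ).filter fun v => v.2 = 0).filter
          fun v => ‖(δ : ℂ) * hexCenter v‖ ≤ R₂).card : ℝ) * (3 * (1 + Mψ) * η) := by
        rw [Finset.sum_ite, Finset.sum_const_zero, add_zero, Finset.sum_const, nsmul_eq_mul]
        ring
    _ ≤ Cc * (3 * (1 + Mψ) * η) := mul_le_mul_of_nonneg_right hcount (by positivity)
    _ < ε := hlt

end ConjugateClassNegligibleOfLimit

open ConjugateClassNegligibleOfLimit in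
/-- **The node from the interior half of Conjecture 2 (limit unspecified).** If in the setting of
`ConjugateClassNegligible` — Dobrushin domain flat near `b`, admissible simply connected
discretisations `Λ_δ` exhausting the compacts of `Ω`, boundary mid-edges `a_δ → a`, `b_δ → b` —
the normalised critical observable `F_δ(e)/F_δ(b_δ)` is, for SOME function `f` continuous on `Ω`
(allowed to depend on the domain and on the discretisation family), uniformly `ε`-close to
`f(δ·mid e)` over the domain mid-edges under any compact `K ⊂ Ω` eventually as `δ → 0⁺`, then
`ConjugateClassNegligible` holds (for its `C¹` test functions; continuity is all that is used).
This is the exponent-free counterpart of `conjugateClassNegligible_of_cruxes`: existence of a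
continuous, orientation-independent local limit of the normalised observable already forces the
conjugate-class average to be `o(δ⁻²) F_δ(b_δ)`, because every black vertex is the barycentre of
its star. -/
theorem conjugateClassNegligible_of_localLimit
    (hlim : ∀ (D : DobrushinDomain) (ρ : ℝ) (Λ : ℝ → Finset HexVertex) (m : ℝ → ℤ)
      (a b : ℝ → Sym2 HexVertex), 0 < ρ →
      D.carrier ∩ Metric.ball (D.pt 1) ρ = {z : ℂ | (D.pt 1).im < z.im} ∩ Metric.ball (D.pt 1) ρ →
      (∀ᶠ δ : ℝ in nhdsWithin 0 (Set.Ioi 0), hexDomainSimplyConnected (Λ δ) ∧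
        a δ ∈ hexDomainBoundary (Λ δ) ∧ b δ ∈ hexDomainBoundary (Λ δ) ∧
        Nonempty (HexMidEdgeSAW (Λ δ) (a δ) (b δ)) ∧
        (hexGraph.induce ((Λ δ : Finset HexVertex) : Set HexVertex)).Preconnected ∧
        (∀ v ∈ Λ δ, (δ : ℂ) * hexCenter v ∈ D.carrier) ∧
        (∀ v : HexVertex, (δ : ℂ) * hexCenter v ∈ Metric.ball (D.pt 1) ρ →
          (v ∈ Λ δ ↔ m δ ≤ v.1 1))) →
      (∀ K : Set ℂ, IsCompact K → K ⊆ D.carrier → ∀ᶠ δ : ℝ in nhdsWithin 0 (Set.Ioi 0),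
        ∀ v : HexVertex, (δ : ℂ) * hexCenter v ∈ K → v ∈ Λ δ) →
      Filter.Tendsto (fun δ : ℝ => (δ : ℂ) * hexMidpoint (a δ)) (nhdsWithin 0 (Set.Ioi 0))
        (nhds (D.pt 0)) →
      Filter.Tendsto (fun δ : ℝ => (δ : ℂ) * hexMidpoint (b δ)) (nhdsWithin 0 (Set.Ioi 0))
        (nhds (D.pt 1)) →
      ∃ f : ℂ → ℂ, ContinuousOn f D.carrier ∧ ∀ K : Set ℂ, IsCompact K → K ⊆ D.carrier →
        ∀ ε : ℝ, 0 < ε → ∀ᶠ δ : ℝ in nhdsWithin 0 (Set.Ioi 0),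
          ∀ e ∈ hexDomainMidEdges (Λ δ), (δ : ℂ) * hexMidpoint e ∈ K →
            ‖hexParafermionicObservable (Λ δ) (a δ) hexCriticalFugacity (5 / 8) e /
                  hexParafermionicObservable (Λ δ) (a δ) hexCriticalFugacity (5 / 8) (b δ) -
                f ((δ : ℂ) * hexMidpoint e)‖ ≤ ε) :
    ConjugateClassNegligible := by
  intro D ρ Λ m a b ψ
  dsimp only
  intro hρ hflat hev hexh ha hb hψ1 hψc hψs
  obtain ⟨f, hf, happ⟩ := hlim D ρ Λ m a b hρ hflat hev hexh ha hb
  exact tendsto_conjClass_zero_of_localLimit D.isOpen Λ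
    (fun δ z => hexParafermionicObservable (Λ δ) (a δ) hexCriticalFugacity (5 / 8) z)
    (fun δ => hexParafermionicObservable (Λ δ) (a δ) hexCriticalFugacity (5 / 8) (b δ))
    f hf hexh happ hψ1.continuous hψc hψs

end Summit.CriticalPhenomena.SAWScalingLimit.Theorems
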